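import Literature.AlgebraicGeometry.ShimuraVarieties.UnitaryCurveSiegelChartMoverClassified
import HarnessLib

/-!
# The Siegel chart of the unitary Shimura curve with movers, carrier classification AND the full (U3) junction on every piece

Topic `AlgebraicGeometry/ShimuraVarieties`; namespace `Literature.AlgebraicGeometry.ShimuraVarieties.UnitaryCurve`.  THEOREMS ONLY (no `def`, no named
fact, no instance, no notation, no `sorry`).  Sequel of ★ `UnitaryCurveSiegelChartMoverClassified` (A-p01 (g26), p847409).  Cell `hodgecm-mathlib` (D-0151),
FLOOR 0, P6 «MOD», E-line `Cruxes/HLiu418/Lines/F0_P6a_PELWitnessE.lean`: the E-LINE ED. 5 list of record (LEAD heir F0P6-plan (g3) 01:18:35Z, cure (J1)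
of A-p04 (g24)'s typed finding 01:16Z) adds ONE `AuxChartGS` field `junction` = the (U3) clause of ★ `siegelModuli_complexUniformisation` for the chart's
pieces AT EVERY `Z ∈ 𝔥_g` — because ★ P-3 `siegelUniversalFamilyUniformisation` (binder `junction` of ★ COV-2 `exists_univFamilyChartCover_of_piece` ∕ ★ COV-6
`exists_isMonHom_of_piece_readings`) needs it on the section domains of the Σ-AN cover, while ED. 4's `f_admissible` carries it only at the image points
`f [v, aKc]`.  The ★ chart constructor HOLDS the full clause (`obtain ⟨Sc, ιc, unif, ⟨hc⟩, hirr, hU2, hU3⟩ := hU …`) and exports it only partially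
((A) at image points, (D3) at `rep c`); this file re-runs the same 30-line assembly and exports `hU3` WHOLE as the extra conjunct (J).  A sequel rather than
an ED. 2 of the ★ file only because two more ~90-line statements would take it past the 400-line cap.  `--supports stmt-HodgeConjecture-24832`,
count-neutral; HC_CM is proved only modulo the printed citations (2 remaining named inputs hLiu418 24832, h413 24833) until rung 0 closes.

* §1 `exists_siegelChartGS_mover_classified_junction` — ★ §1 + (J), general Hodge-embedding datum.
* §2 `exists_siegelChartGS_auxComplexStructureV_mover_classified_junction_of_sigDatum` — ★ §2 + (J), at Deligne's `J_Φ` with the signature datum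
  (the ED. 5 `stub_E123` constructor).

## References
* [MumfordFogartyKirwan1994] D. Mumford, J. Fogarty, F. Kirwan, *Geometric Invariant Theory* (3rd ed. 1994), Appendix to Ch. 7 §A pp. 234–235.
* [Deligne1971TravauxShimura] P. Deligne, *Travaux de Shimura* (1971), Prop. 1.15 p. 132, 4.11–4.12 pp. 148–149, Exemple 4.16 p. 150.
* [Deligne1979ShimuraVarieties] P. Deligne, *Variétés de Shimura* (1979), Prop. 2.3.10 (PDF p. 32 of Milne's translation).
* [Milne2005ShimuraVarieties] J. S. Milne, *Introduction to Shimura varieties* (2005), Lemma 5.13 p. 57, Thm. 6.11 p. 74, (63) p. 116.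
* [RapoportSmithlingZhang2020Diagonal] M. Rapoport, B. Smithling, W. Zhang (2020), §3.2 and Prop. 3.7 (proof) pp. 11–14.
-/

set_option autoImplicit false

noncomputable section

open Function Matrix NumberField IsDedekindDomain CategoryTheory CategoryTheory.Limits AlgebraicGeometry
open scoped Matrix ComplexOrder TensorProduct
open Literature.AlgebraicGeometry.Motives (SchemeOver ComplexPoints AlgPoints specOver CMType)
open Literature.AlgebraicGeometry.AbelianSchemes (PolarizedAbelianSchemeWithLevel)
open Literature.NumberTheory.Automorphic (siegelUpperHalfSpace)
open Literature.NumberTheory.Automorphic.UnitaryGroup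
open Literature.AlgebraicGeometry.ModuliOfAbelianVarieties
open Literature.AlgebraicGeometry.ModuliOfAbelianVarieties.SiegelModuli (C0 mem_C0_iff jOfSiegel jOfSiegel_mem_C0)

namespace Literature.AlgebraicGeometry.ShimuraVarieties

open UnitaryCanonicalModel
open Literature.AlgebraicGeometry.ShimuraVarieties.UnitaryCurve.AuxV

namespace UnitaryCurve

variable {L : Type} [Field L] [NumberField L] [IsCMField L] {Jstar : Matrix (Fin 2) (Fin 2) L} {τ : L →+* ℂ}
variable {g : ℕ} {δ : Fin g → ℕ} {N : ℕ}

/-! ### §1. The general datum, with the junction -/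

section Chart


variable (J : (Fin 2 → ℂ) → Matrix (Fin g ⊕ Fin g) (Fin g ⊕ Fin g) ℝ)
  (hJ : ∀ v : Fin 2 → ℂ, v ∈ negCone (Jstar.map τ) → J v ∈ C0pm δ)
  (b : ↥(finAdelic (↥(maximalRealSubfield L)) L (IsCMField.complexConj L) 2 Jstar) →* ↥(gspFinAdelic δ))
  (bq : ↥(rational (↥(maximalRealSubfield L)) L (IsCMField.complexConj L) 2 Jstar) →* ↥(gspRational δ))

/-- **THE SIEGEL CHART WITH MOVERS, CARRIER CLASSIFICATION AND THE FULL (U3) JUNCTION** — ★ `exists_siegelChartGS_mover_classified` (all clauses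
verbatim) plus (J): on every piece `c`, for EVERY principal representative `(u′, r)` of `c` and EVERY `Z ∈ 𝔥_g`, the universal triple pulled back to
`ιc_c (unif_c Z)` is admissible for `(Z, r)` ((U3∃)) and every admissible triple is classified by that point ((U3-D3)) — clause (U3) of ★
`siegelModuli_complexUniformisation` for the chart's OWN pieces, which the ★ proof held as `hU3` and consumed only at the image points (A) and at
`rep c` (D3).  Same proof, `hU3` exported whole. [cite: MumfordFogartyKirwan1994, Appendix to Ch. 7 §A pp. 234–235]
[cite: Deligne1971TravauxShimura, Prop. 1.15 p. 132, 4.11–4.12, Exemple 4.16 p. 150] [cite: Deligne1979ShimuraVarieties, Prop. 2.3.10]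
[cite: Milne2005ShimuraVarieties, Lemma 5.13 p. 57, Thm. 6.11 p. 74 and (63) p. 116] -/
theorem exists_siegelChartGS_mover_classified_junction (hU : siegelModuli_complexUniformisation) (hg : 0 < g) (hδ : IsPolarizationType δ) (hN : 3 ≤ N)
    (𝓜 : SiegelFineModuliScheme g N δ)
    (hJneg : ∀ v : Fin 2 → ℂ, v ∈ negCone (Jstar.map τ) → -J v ∈ C0 δ)
    (hJsmul : ∀ c : ℂ, c ≠ 0 → ∀ v : Fin 2 → ℂ, v ∈ negCone (Jstar.map τ) → J (c • v) = J v)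
    (hb : ∀ γ : ↥(rational (↥(maximalRealSubfield L)) L (IsCMField.complexConj L) 2 Jstar),
      b (rationalToFinAdelic (↥(maximalRealSubfield L)) L (IsCMField.complexConj L) 2 Jstar γ) = gspRationalToFinAdelic δ (bq γ))
    (hJrat : ∀ (γ : ↥(rational (↥(maximalRealSubfield L)) L (IsCMField.complexConj L) 2 Jstar)) (v : Fin 2 → ℂ),
      v ∈ negCone (Jstar.map τ) →
        J (((ratToGLℂ L Jstar τ γ : GL (Fin 2) ℂ) : Matrix (Fin 2) (Fin 2) ℂ) *ᵥ v) =
          conjJ ((gspRationalToReal δ (bq γ) : ↥(gspReal δ)) : GL (Fin g ⊕ Fin g) ℝ) (J v))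
    (K : Subgroup ↥(finAdelic (↥(maximalRealSubfield L)) L (IsCMField.complexConj L) 2 Jstar))
    (hle : K ≤ (principalLevelSubgroup δ N).comap b)
    (hZ : ∀ γ : GL (Fin g ⊕ Fin g) ℝ, γ ∈ gspReal δ → (∀ v : Fin 2 → ℂ, v ∈ negCone (Jstar.map τ) → conjJ γ (J v) ∈ C0 δ) →
      ∃ Z : (Fin 2 → ℂ) → Matrix (Fin g) (Fin g) ℂ,
        (∀ i j : Fin g, DifferentiableOn ℂ (fun v => Z v i j) (negCone (Jstar.map τ))) ∧
          ∀ v : Fin 2 → ℂ, v ∈ negCone (Jstar.map τ) → Z v ∈ siegelUpperHalfSpace g ∧ conjJ γ (J v) = jOfSiegel δ (Z v)) :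
    haveI : IsLocallyNoetherian (specOver ℚ ℂ).left := inferInstanceAs (IsLocallyNoetherian (Spec (CommRingCat.of ℂ)))
    ∃ (Sc : (ZMod N)ˣ → SchemeOver ℂ) (ιc : ∀ c, Sc c ⟶ (Motives.baseChange ℚ ℂ).obj 𝓜.M)
      (unif : ∀ _c : (ZMod N)ˣ, Matrix (Fin g) (Fin g) ℂ → ComplexPoints (Sc _c))
      (f : ShimuraSetGS L Jstar τ K → ComplexPoints 𝓜.M)
      (piece : ↥(finAdelic (↥(maximalRealSubfield L)) L (IsCMField.complexConj L) 2 Jstar) → (ZMod N)ˣ)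
      (Z : ↥(finAdelic (↥(maximalRealSubfield L)) L (IsCMField.complexConj L) 2 Jstar) → (Fin 2 → ℂ) → Matrix (Fin g) (Fin g) ℂ)
      (u : (ZMod N)ˣ → finAdeleQˣ) (rep : (ZMod N)ˣ → ↥(gspFinAdelic δ))
      (pts : ComplexPoints ((Motives.baseChange ℚ ℂ).obj 𝓜.M) ≃ SiegelShimuraSet δ (principalLevelSubgroup δ N))
      (q : ↥(finAdelic (↥(maximalRealSubfield L)) L (IsCMField.complexConj L) 2 Jstar) → ↥(gspRational δ)),
    -- (U1) component cofan of irreducible pieces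
      Nonempty (IsColimit (Cofan.mk ((Motives.baseChange ℚ ℂ).obj 𝓜.M) ιc)) ∧
      (∀ c, IrreducibleSpace (Sc c).left) ∧
    -- (U2+) analytic clauses per piece
      (∀ c, ContinuousOn (unif c) (siegelUpperHalfSpace g)) ∧
      (∀ c, IsOpenMap ((siegelUpperHalfSpace g).restrict (unif c))) ∧
      (∀ c, Set.SurjOn (unif c) (siegelUpperHalfSpace g) Set.univ) ∧
      (∀ c, ∀ W ∈ siegelUpperHalfSpace g, ∀ W' ∈ siegelUpperHalfSpace g,
        unif c W = unif c W' ↔ ∃ M ∈ siegelLevelGroup δ N, ∃ C : (Fin g → ℂ) ≃ₗ[ℂ] (Fin g → ℂ),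
          ∀ x : Fin g ⊕ Fin g → ℝ, C (siegelPeriodMap δ W x) = siegelPeriodMap δ W' (intAct M x)) ∧
      (∀ (c : (ZMod N)ˣ) (U : (Sc c).left.affineOpens) (s : (Sc c).left.presheaf.obj (Opposite.op (↑U : (Sc c).left.Opens))),
        DifferentiableOn ℂ (fun W ↦ AlgPoints.evalOrZero (↑U : (Sc c).left.Opens) s (unif c W))
          (siegelUpperHalfSpace g ∩ unif c ⁻¹' {P | P.pt ∈ (↑U : (Sc c).left.Opens)})) ∧
    -- principal representatives (the five (U3) premisses)
      (∀ c, (∀ w, Valued.v ((u c : finAdeleQ) w) = 1) ∧ (u c : finAdeleQ) - ((c : ZMod N).val : ℕ) ∈ levelIdeal N ∧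
        rep c ∈ principalLevelSubgroup δ 1 ∧
          IsMultiplier (typeFormOver δ finAdeleQ) (rep c : GL (Fin g ⊕ Fin g) finAdeleQ) (u c) ∧
            ((rep c : GL (Fin g ⊕ Fin g) finAdeleQ) : Matrix (Fin g ⊕ Fin g) (Fin g ⊕ Fin g) finAdeleQ) =
              Matrix.fromBlocks 1 0 0 ((u c : finAdeleQ) • (1 : Matrix (Fin g) (Fin g) finAdeleQ))) ∧
    -- (P) the point map: `Z_hol`, `Z_mem`, `f_mk`, the Shimura-set shadow
      (∀ a (i j : Fin g), DifferentiableOn ℂ (fun v => Z a v i j) (negCone (Jstar.map τ))) ∧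
      (∀ a (v : Fin 2 → ℂ), v ∈ negCone (Jstar.map τ) → Z a v ∈ siegelUpperHalfSpace g) ∧
      (∀ (v : Fin 2 → ℂ) (hv : v ∈ negCone (Jstar.map τ)) a,
        f (ShimuraSetGS.mk L Jstar τ K v hv a) =
          (AlgPoints.baseChangeEquiv (algebraMap ℚ ℂ) 𝓜.M).symm (AlgPoints.map (ιc (piece a)) (unif (piece a) (Z a v)))) ∧
      (∀ (v : Fin 2 → ℂ) (hv : v ∈ negCone (Jstar.map τ)) a,
        pts (AlgPoints.baseChangeEquiv (algebraMap ℚ ℂ) 𝓜.M (f (ShimuraSetGS.mk L Jstar τ K v hv a))) =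
          SiegelShimuraSet.mk δ (principalLevelSubgroup δ N) ⟨J v, hJ v hv⟩ (b a)) ∧
      (∀ (v : Fin 2 → ℂ) (hv : v ∈ negCone (Jstar.map τ)) a, ∃ hZv : Z a v ∈ siegelUpperHalfSpace g,
        SiegelShimuraSet.mk δ (principalLevelSubgroup δ N) ⟨J v, hJ v hv⟩ (b a) =
          SiegelShimuraSet.mk δ (principalLevelSubgroup δ N)
            ⟨jOfSiegel δ (Z a v), C0_subset_C0pm δ (jOfSiegel_mem_C0 hδ.1 hZv)⟩ (rep (piece a))) ∧
      (∀ (c : (ZMod N)ˣ) (W : Matrix (Fin g) (Fin g) ℂ) (hW : W ∈ siegelUpperHalfSpace g),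
        pts (AlgPoints.map (ιc c) (unif c W)) =
          SiegelShimuraSet.mk δ (principalLevelSubgroup δ N) ⟨jOfSiegel δ W, C0_subset_C0pm δ (jOfSiegel_mem_C0 hδ.1 hW)⟩ (rep c)) ∧
    -- (A) admissibility of the universal triple at the image point ((U3∃)) and classification ((U3-D3))
      (∀ (v : Fin 2 → ℂ) (hv : v ∈ negCone (Jstar.map τ)) a, ∃ hZv : Z a v ∈ siegelUpperHalfSpace g,
        (∃ (P' : PolarizedAbelianSchemeWithLevel g N δ (specOver ℚ ℂ).left)
            (G : P'.A.X.left ⟶ 𝓜.univ.A.X.left) (Ĝ : P'.D.hat.X.left ⟶ 𝓜.univ.D.hat.X.left),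
            P'.IsBaseChangeVia 𝓜.univ (f (ShimuraSetGS.mk L Jstar τ K v hv a)).left G Ĝ ∧
              IsAdmissibleAt hδ (rep (piece a)) (Z a v) hZv P') ∧
        ∀ P' : PolarizedAbelianSchemeWithLevel g N δ (specOver ℚ ℂ).left, IsAdmissibleAt hδ (rep (piece a)) (Z a v) hZv P' →
          f (ShimuraSetGS.mk L Jstar τ K v hv a) = 𝓜.classifyingMap (specOver ℚ ℂ) P') ∧
    -- (Q) THE MOVERS
      (∀ (v : Fin 2 → ℂ), v ∈ negCone (Jstar.map τ) → ∀ a,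
        conjJ (((gspRationalToReal δ (q a))⁻¹ : ↥(gspReal δ)) : GL (Fin g ⊕ Fin g) ℝ) (J v) = jOfSiegel δ (Z a v) ∧
          gspRationalToFinAdelic δ (q a) • ((rep (piece a) : gspFinAdelic δ) : gspFinAdelic δ ⧸ principalLevelSubgroup δ N) =
            ((b a : gspFinAdelic δ) : gspFinAdelic δ ⧸ principalLevelSubgroup δ N)) ∧
    -- (D3) CARRIER CLASSIFICATION on every piece (★ (U3-D3) at the chart's own uniformisation; the `hD3` binder of the reciprocity glue)
      (∀ (c : (ZMod N)ˣ) (W : Matrix (Fin g) (Fin g) ℂ) (hW : W ∈ siegelUpperHalfSpace g)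
        (P' : PolarizedAbelianSchemeWithLevel g N δ (specOver ℚ ℂ).left), IsAdmissibleAt hδ (rep c) W hW P' →
          AlgPoints.map (ιc c) (unif c W) =
            AlgPoints.baseChangeEquiv (algebraMap ℚ ℂ) 𝓜.M (𝓜.classifyingMap (specOver ℚ ℂ) P')) ∧
    -- (J) THE FULL (U3) JUNCTION on every piece `c`, for EVERY principal representative `(u', r)` of `c` and EVERY `Z ∈ 𝔥_g`
    --     (= clause (U3) of ★ `siegelModuli_complexUniformisation` for the chart's own pieces, exported whole)
      (∀ (c : (ZMod N)ˣ) (u' : finAdeleQˣ) (r : gspFinAdelic δ),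
        (∀ v, Valued.v ((u' : finAdeleQ) v) = 1) →
        (u' : finAdeleQ) - ((c : ZMod N).val : ℕ) ∈ levelIdeal N →
        r ∈ principalLevelSubgroup δ 1 →
        IsMultiplier (typeFormOver δ finAdeleQ) (r : GL (Fin g ⊕ Fin g) finAdeleQ) u' →
        ((r : GL (Fin g ⊕ Fin g) finAdeleQ) : Matrix (Fin g ⊕ Fin g) (Fin g ⊕ Fin g) finAdeleQ) =
          Matrix.fromBlocks 1 0 0 ((u' : finAdeleQ) • (1 : Matrix (Fin g) (Fin g) finAdeleQ)) →
        ∀ (Z : Matrix (Fin g) (Fin g) ℂ) (hZ : Z ∈ siegelUpperHalfSpace g),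
          haveI : IsLocallyNoetherian (specOver ℚ ℂ).left :=
            inferInstanceAs (IsLocallyNoetherian (Spec (CommRingCat.of ℂ)))
          (∃ (P' : PolarizedAbelianSchemeWithLevel g N δ (specOver ℚ ℂ).left)
              (G : P'.A.X.left ⟶ 𝓜.univ.A.X.left) (Ĝ : P'.D.hat.X.left ⟶ 𝓜.univ.D.hat.X.left),
              P'.IsBaseChangeVia 𝓜.univ
                  ((AlgPoints.baseChangeEquiv (algebraMap ℚ ℂ) 𝓜.M).symm (AlgPoints.map (ιc c) (unif c Z))).left G Ĝ ∧
              IsAdmissibleAt hδ r Z hZ P') ∧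
          (∀ (P' : PolarizedAbelianSchemeWithLevel g N δ (specOver ℚ ℂ).left), IsAdmissibleAt hδ r Z hZ P' →
              AlgPoints.map (ιc c) (unif c Z)
                = AlgPoints.baseChangeEquiv (algebraMap ℚ ℂ) 𝓜.M (𝓜.classifyingMap (specOver ℚ ℂ) P'))) := by
  classical
  -- the clauses of (U) at `𝓜`
  obtain ⟨Sc, ιc, unif, ⟨hc⟩, hirr, hU2, hU3⟩ := hU g N δ hg hδ hN 𝓜
  have hsurj : ∀ c, Set.SurjOn (unif c) (siegelUpperHalfSpace g) Set.univ := fun c => (hU2 c).2.2.1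
  have hiff : ∀ c, ∀ W ∈ siegelUpperHalfSpace g, ∀ W' ∈ siegelUpperHalfSpace g,
      unif c W = unif c W' ↔ ∃ M ∈ siegelLevelGroup δ N, ∃ C : (Fin g → ℂ) ≃ₗ[ℂ] (Fin g → ℂ),
        ∀ x : Fin g ⊕ Fin g → ℝ, C (siegelPeriodMap δ W x) = siegelPeriodMap δ W' (intAct M x) := fun c => (hU2 c).2.2.2.1
  -- ★ FILE D §2 over these pieces
  obtain ⟨f, piece, Z, u, rep, pts, q, hrep, hZd, hZm, hfmk, hptsf, hmkrep, hval, hq⟩ :=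
    exists_moduliPointMapGS_mover J hJ b bq hg hδ hN hJneg hJsmul hb hJrat K hle hZ hc unif hsurj hiff
  refine ⟨Sc, ιc, unif, fun x => (AlgPoints.baseChangeEquiv (algebraMap ℚ ℂ) 𝓜.M).symm (f x), piece, Z, u, rep, pts, q,
    ⟨hc⟩, hirr, fun c => (hU2 c).1, fun c => (hU2 c).2.1, hsurj, hiff, fun c => (hU2 c).2.2.2.2, hrep, hZd, hZm,
    fun v hv a => congrArg (AlgPoints.baseChangeEquiv (algebraMap ℚ ℂ) 𝓜.M).symm (hfmk v hv a),
    fun v hv a => by show pts (AlgPoints.baseChangeEquiv _ 𝓜.M ((AlgPoints.baseChangeEquiv _ 𝓜.M).symm (f _))) = _;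
                     rw [Equiv.apply_symm_apply, hptsf], hmkrep, hval,
    fun v hv a => ?_, hq, fun c W hW P' hP' => ?_, fun c u' r hu1 hu2 hr1 hr2 hr3 Z hZ => hU3 c u' r hu1 hu2 hr1 hr2 hr3 Z hZ⟩
  · -- (A) at `(piece a, u (piece a), rep (piece a))` and `Z a v`
    obtain ⟨hu1, hu2, hr1, hr2, hr3⟩ := hrep (piece a)
    have h3 := hU3 (piece a) (u (piece a)) (rep (piece a)) hu1 hu2 hr1 hr2 hr3 (Z a v) (hZm a v hv)
    refine ⟨hZm a v hv, ?_, fun P' hP' => ?_⟩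
    · obtain ⟨P', G, Ĝ, hbc, hadm⟩ := h3.1
      refine ⟨P', G, Ĝ, ?_, hadm⟩
      simp only [hfmk]
      exact hbc
    · show (AlgPoints.baseChangeEquiv (algebraMap ℚ ℂ) 𝓜.M).symm (f _) = _
      rw [Equiv.symm_apply_eq, hfmk]
      exact h3.2 P' hP'
  · -- (D3) on the carrier
    obtain ⟨hu1, hu2, hr1, hr2, hr3⟩ := hrep c
    exact (hU3 c (u c) (rep c) hu1 hu2 hr1 hr2 hr3 W hW).2 P' hP'

end Chart

/-! ### §2. At Deligne's `J_Φ` with the E-line's signature datum, with the junction -/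

/-- **THE SIEGEL CHART AT `J_Φ` WITH MOVERS, CARRIER CLASSIFICATION AND THE FULL (U3) JUNCTION, FROM A SIGNATURE DATUM FOR `t • J⋆`** — ★
`exists_siegelChartGS_auxComplexStructureV_mover_classified_of_sigDatum` (conclusion verbatim) plus (J).  This is the constructor the E-line ED. 5
`stub_E123` body calls to fill the new `AuxChartGS.junction` field (the (U3) binder of ★ P-3 `siegelUniversalFamilyUniformisation` for the chart's pieces,
consumed by ★ COV-2 ∕ ★ COV-6 of the Σ-AN socket). [cite: Deligne1979ShimuraVarieties, Prop. 2.3.10 (PDF p. 32)]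
[cite: Milne2005ShimuraVarieties, Lemma 5.13 p. 57, Thm. 6.11 p. 74] [cite: RapoportSmithlingZhang2020Diagonal, Remark 3.2 (ii)(iii) pp. 9–10 and Prop. 3.7 pp. 13–14] -/
theorem exists_siegelChartGS_auxComplexStructureV_mover_classified_junction_of_sigDatum (hU : siegelModuli_complexUniformisation) (hg : 0 < g)
    (hδ : IsPolarizationType δ) (hN : 3 ≤ N) (𝓜 : SiegelFineModuliScheme g N δ)
    (Φ : CMType L) (hΦ : τ ∈ Φ.1) {ξ : L} (F : SymplecticFrameV L (RingHom.id L) Jstar ξ g δ)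
    (hJ : (Jstar.map (IsCMField.complexConj L))ᵀ = Jstar) {t : L} (hτt : 0 < (τ t).re) (hτt' : (τ t).im = 0)
    (hξ : ∀ ρ : Φ.1, (ρ.1 (ξ * t⁻¹)).im < 0) (T : GL (Fin 2) ℂ)
    (hT : (T : Matrix (Fin 2) (Fin 2) ℂ)ᴴ * (t • Jstar).map τ * (T : Matrix (Fin 2) (Fin 2) ℂ) = signatureMatrix 1)
    (hpos : ∀ σ : L →+* ℂ, InfinitePlace.mk σ ≠ InfinitePlace.mk τ → ((t • Jstar).map σ).PosDef)
    (K : Subgroup ↥(finAdelic (↥(maximalRealSubfield L)) L (IsCMField.complexConj L) 2 Jstar))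
    (hle : K ≤ (principalLevelSubgroup δ N).comap ((auxToGspFinV F).comp (MonoidHom.inl _ _))) :
    haveI : IsLocallyNoetherian (specOver ℚ ℂ).left := inferInstanceAs (IsLocallyNoetherian (Spec (CommRingCat.of ℂ)))
    ∃ (Sc : (ZMod N)ˣ → SchemeOver ℂ) (ιc : ∀ c, Sc c ⟶ (Motives.baseChange ℚ ℂ).obj 𝓜.M)
      (unif : ∀ _c : (ZMod N)ˣ, Matrix (Fin g) (Fin g) ℂ → ComplexPoints (Sc _c))
      (f : ShimuraSetGS L Jstar τ K → ComplexPoints 𝓜.M)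
      (piece : ↥(finAdelic (↥(maximalRealSubfield L)) L (IsCMField.complexConj L) 2 Jstar) → (ZMod N)ˣ)
      (Z : ↥(finAdelic (↥(maximalRealSubfield L)) L (IsCMField.complexConj L) 2 Jstar) → (Fin 2 → ℂ) → Matrix (Fin g) (Fin g) ℂ)
      (u : (ZMod N)ˣ → finAdeleQˣ) (rep : (ZMod N)ˣ → ↥(gspFinAdelic δ))
      (pts : ComplexPoints ((Motives.baseChange ℚ ℂ).obj 𝓜.M) ≃ SiegelShimuraSet δ (principalLevelSubgroup δ N))
      (q : ↥(finAdelic (↥(maximalRealSubfield L)) L (IsCMField.complexConj L) 2 Jstar) → ↥(gspRational δ)),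
    -- (U1) component cofan of irreducible pieces
      Nonempty (IsColimit (Cofan.mk ((Motives.baseChange ℚ ℂ).obj 𝓜.M) ιc)) ∧
      (∀ c, IrreducibleSpace (Sc c).left) ∧
    -- (U2+) analytic clauses per piece
      (∀ c, ContinuousOn (unif c) (siegelUpperHalfSpace g)) ∧
      (∀ c, IsOpenMap ((siegelUpperHalfSpace g).restrict (unif c))) ∧
      (∀ c, Set.SurjOn (unif c) (siegelUpperHalfSpace g) Set.univ) ∧
      (∀ c, ∀ W ∈ siegelUpperHalfSpace g, ∀ W' ∈ siegelUpperHalfSpace g,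
        unif c W = unif c W' ↔ ∃ M ∈ siegelLevelGroup δ N, ∃ C : (Fin g → ℂ) ≃ₗ[ℂ] (Fin g → ℂ),
          ∀ x : Fin g ⊕ Fin g → ℝ, C (siegelPeriodMap δ W x) = siegelPeriodMap δ W' (intAct M x)) ∧
      (∀ (c : (ZMod N)ˣ) (U : (Sc c).left.affineOpens) (s : (Sc c).left.presheaf.obj (Opposite.op (↑U : (Sc c).left.Opens))),
        DifferentiableOn ℂ (fun W ↦ AlgPoints.evalOrZero (↑U : (Sc c).left.Opens) s (unif c W))
          (siegelUpperHalfSpace g ∩ unif c ⁻¹' {P | P.pt ∈ (↑U : (Sc c).left.Opens)})) ∧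
    -- principal representatives (the five (U3) premisses)
      (∀ c, (∀ w, Valued.v ((u c : finAdeleQ) w) = 1) ∧ (u c : finAdeleQ) - ((c : ZMod N).val : ℕ) ∈ levelIdeal N ∧
        rep c ∈ principalLevelSubgroup δ 1 ∧
          IsMultiplier (typeFormOver δ finAdeleQ) (rep c : GL (Fin g ⊕ Fin g) finAdeleQ) (u c) ∧
            ((rep c : GL (Fin g ⊕ Fin g) finAdeleQ) : Matrix (Fin g ⊕ Fin g) (Fin g ⊕ Fin g) finAdeleQ) =
              Matrix.fromBlocks 1 0 0 ((u c : finAdeleQ) • (1 : Matrix (Fin g) (Fin g) finAdeleQ))) ∧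
    -- (P) the point map: `Z_hol`, `Z_mem`, `f_mk`, the Shimura-set shadow
      (∀ a (i j : Fin g), DifferentiableOn ℂ (fun v => Z a v i j) (negCone (Jstar.map τ))) ∧
      (∀ a (v : Fin 2 → ℂ), v ∈ negCone (Jstar.map τ) → Z a v ∈ siegelUpperHalfSpace g) ∧
      (∀ (v : Fin 2 → ℂ) (hv : v ∈ negCone (Jstar.map τ)) a,
        f (ShimuraSetGS.mk L Jstar τ K v hv a) =
          (AlgPoints.baseChangeEquiv (algebraMap ℚ ℂ) 𝓜.M).symm (AlgPoints.map (ιc (piece a)) (unif (piece a) (Z a v)))) ∧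
      (∀ (v : Fin 2 → ℂ) (hv : v ∈ negCone (Jstar.map τ)) a,
        pts (AlgPoints.baseChangeEquiv (algebraMap ℚ ℂ) 𝓜.M (f (ShimuraSetGS.mk L Jstar τ K v hv a))) =
          SiegelShimuraSet.mk δ (principalLevelSubgroup δ N) ⟨auxComplexStructureV F τ Φ v,
            auxComplexStructureV_mem_C0pm_of_sigDatum F Φ hΦ hJ hτt hτt' hξ T hT hpos v hv⟩ (((auxToGspFinV F).comp (MonoidHom.inl _ _)) a)) ∧
      (∀ (v : Fin 2 → ℂ) (hv : v ∈ negCone (Jstar.map τ)) a, ∃ hZv : Z a v ∈ siegelUpperHalfSpace g,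
        SiegelShimuraSet.mk δ (principalLevelSubgroup δ N) ⟨auxComplexStructureV F τ Φ v,
            auxComplexStructureV_mem_C0pm_of_sigDatum F Φ hΦ hJ hτt hτt' hξ T hT hpos v hv⟩ (((auxToGspFinV F).comp (MonoidHom.inl _ _)) a) =
          SiegelShimuraSet.mk δ (principalLevelSubgroup δ N)
            ⟨jOfSiegel δ (Z a v), C0_subset_C0pm δ (jOfSiegel_mem_C0 hδ.1 hZv)⟩ (rep (piece a))) ∧
      (∀ (c : (ZMod N)ˣ) (W : Matrix (Fin g) (Fin g) ℂ) (hW : W ∈ siegelUpperHalfSpace g),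
        pts (AlgPoints.map (ιc c) (unif c W)) =
          SiegelShimuraSet.mk δ (principalLevelSubgroup δ N) ⟨jOfSiegel δ W, C0_subset_C0pm δ (jOfSiegel_mem_C0 hδ.1 hW)⟩ (rep c)) ∧
    -- (A) admissibility of the universal triple at the image point ((U3∃)) and classification ((U3-D3))
      (∀ (v : Fin 2 → ℂ) (hv : v ∈ negCone (Jstar.map τ)) a, ∃ hZv : Z a v ∈ siegelUpperHalfSpace g,
        (∃ (P' : PolarizedAbelianSchemeWithLevel g N δ (specOver ℚ ℂ).left)
            (G : P'.A.X.left ⟶ 𝓜.univ.A.X.left) (Ĝ : P'.D.hat.X.left ⟶ 𝓜.univ.D.hat.X.left),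
            P'.IsBaseChangeVia 𝓜.univ (f (ShimuraSetGS.mk L Jstar τ K v hv a)).left G Ĝ ∧
              IsAdmissibleAt hδ (rep (piece a)) (Z a v) hZv P') ∧
        ∀ P' : PolarizedAbelianSchemeWithLevel g N δ (specOver ℚ ℂ).left, IsAdmissibleAt hδ (rep (piece a)) (Z a v) hZv P' →
          f (ShimuraSetGS.mk L Jstar τ K v hv a) = 𝓜.classifyingMap (specOver ℚ ℂ) P') ∧
    -- (Q) THE MOVERS: `Z a` is E2's period function in the frame `(q a)_ℝ⁻¹`, `q a` tied to `a` adelically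
      (∀ (v : Fin 2 → ℂ), v ∈ negCone (Jstar.map τ) → ∀ a,
        conjJ (((gspRationalToReal δ (q a))⁻¹ : ↥(gspReal δ)) : GL (Fin g ⊕ Fin g) ℝ) (auxComplexStructureV F τ Φ v) = jOfSiegel δ (Z a v) ∧
          gspRationalToFinAdelic δ (q a) • ((rep (piece a) : gspFinAdelic δ) : gspFinAdelic δ ⧸ principalLevelSubgroup δ N) =
            ((((auxToGspFinV F).comp (MonoidHom.inl _ _)) a : gspFinAdelic δ) : gspFinAdelic δ ⧸ principalLevelSubgroup δ N)) ∧
    -- (D3) CARRIER CLASSIFICATION on every piece (the `hD3` binder of the reciprocity glue)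
      (∀ (c : (ZMod N)ˣ) (W : Matrix (Fin g) (Fin g) ℂ) (hW : W ∈ siegelUpperHalfSpace g)
        (P' : PolarizedAbelianSchemeWithLevel g N δ (specOver ℚ ℂ).left), IsAdmissibleAt hδ (rep c) W hW P' →
          AlgPoints.map (ιc c) (unif c W) =
            AlgPoints.baseChangeEquiv (algebraMap ℚ ℂ) 𝓜.M (𝓜.classifyingMap (specOver ℚ ℂ) P')) ∧
    -- (J) THE FULL (U3) JUNCTION on every piece `c`, for EVERY principal representative `(u', r)` of `c` and EVERY `Z ∈ 𝔥_g`
    --     (= clause (U3) of ★ `siegelModuli_complexUniformisation` for the chart's own pieces, exported whole)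
      (∀ (c : (ZMod N)ˣ) (u' : finAdeleQˣ) (r : gspFinAdelic δ),
        (∀ v, Valued.v ((u' : finAdeleQ) v) = 1) →
        (u' : finAdeleQ) - ((c : ZMod N).val : ℕ) ∈ levelIdeal N →
        r ∈ principalLevelSubgroup δ 1 →
        IsMultiplier (typeFormOver δ finAdeleQ) (r : GL (Fin g ⊕ Fin g) finAdeleQ) u' →
        ((r : GL (Fin g ⊕ Fin g) finAdeleQ) : Matrix (Fin g ⊕ Fin g) (Fin g ⊕ Fin g) finAdeleQ) =
          Matrix.fromBlocks 1 0 0 ((u' : finAdeleQ) • (1 : Matrix (Fin g) (Fin g) finAdeleQ)) →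
        ∀ (Z : Matrix (Fin g) (Fin g) ℂ) (hZ : Z ∈ siegelUpperHalfSpace g),
          haveI : IsLocallyNoetherian (specOver ℚ ℂ).left :=
            inferInstanceAs (IsLocallyNoetherian (Spec (CommRingCat.of ℂ)))
          (∃ (P' : PolarizedAbelianSchemeWithLevel g N δ (specOver ℚ ℂ).left)
              (G : P'.A.X.left ⟶ 𝓜.univ.A.X.left) (Ĝ : P'.D.hat.X.left ⟶ 𝓜.univ.D.hat.X.left),
              P'.IsBaseChangeVia 𝓜.univ
                  ((AlgPoints.baseChangeEquiv (algebraMap ℚ ℂ) 𝓜.M).symm (AlgPoints.map (ιc c) (unif c Z))).left G Ĝ ∧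
              IsAdmissibleAt hδ r Z hZ P') ∧
          (∀ (P' : PolarizedAbelianSchemeWithLevel g N δ (specOver ℚ ℂ).left), IsAdmissibleAt hδ r Z hZ P' →
              AlgPoints.map (ιc c) (unif c Z)
                = AlgPoints.baseChangeEquiv (algebraMap ℚ ℂ) 𝓜.M (𝓜.classifyingMap (specOver ℚ ℂ) P'))) :=
  exists_siegelChartGS_mover_classified_junction (auxComplexStructureV F τ Φ)
    (auxComplexStructureV_mem_C0pm_of_sigDatum F Φ hΦ hJ hτt hτt' hξ T hT hpos)
    ((auxToGspFinV F).comp (MonoidHom.inl _ _)) ((auxToGspRatV F).comp (MonoidHom.inl _ _)) hU hg hδ hN 𝓜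
    (neg_auxComplexStructureV_mem_C0_of_sigDatum F Φ hΦ hJ hτt hτt' hξ T hT hpos)
    (fun _ hc v _ => auxComplexStructureV_smul F τ Φ v hc) (hb_auxToGspFinV_inl F)
    (auxComplexStructureV_hJrat F τ Φ (negCone (Jstar.map τ))) K hle
    (fun γ _ hC => periodChartV L F Φ τ hδ.1 γ hC)

end UnitaryCurve

end Literature.AlgebraicGeometry.ShimuraVarieties

end
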